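import Mathlib
import Literature.Analysis.FluidPDE.SelfSimilarCollapseAnsatz
import Literature.Analysis.FluidPDE.ForwardDSSExistenceLocalProofs
import Summits.NavierStokesRegularity.NavierStokesRegularity.Theorems.EulerZoomLiouvillePowerGaugeEulerLiouvilleSelfSimilarPressureSlavingProfile
import HarnessLib

/-!
# Crux E `PowerGaugeEulerLiouville` (stmt-NavierStokesRegularity-19832): PRESSURE SLAVING on a PAST sub-slab — a ONE-SIDED scale-invariant
# pressure class below a top time `S ≤ 0` IS a self-similar ansatz
# (lane «pressure slaving», file 2 = shifted / past strata; LEAD ns-typeII-p2 g11 10:45:58Z (1); width seat ns-ezl-w3 g2)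

Route `EulerZoomLiouville` (NavierStokesRegularity), crux E.  One-sided twin of `PressureSlaving.exists_profile_of_scaleInvariant`
(`…SelfSimilarPressureSlavingProfile`, the case `S = 0`, all `β > 0`).  Pure measure theory: let `p` be a.e.-strongly measurable on the slab
`(−∞, S) × ℝ³`, `S ≤ 0`, and a.e.-invariant under the self-similar rescalings of rate `g` that push INTO the past,
`p(s, y) = β^{2(1−g)} p(β s, β^{g} y)` for a.e. `(s, y)` with `s < S`, for every `β ≥ 1` (for `S < 0` the slab is not invariant under `β < 1`).
Then there is a measurable profile `Q : ℝ³ → ℝ` with `p(s) = selfSimilarCollapsePressure g 0 Q s` a.e. on `ℝ³` for a.e. `s < S`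
(`PressureSlaving.exists_profile_of_scaleInvariant_oneSided`).

Proof (`Φ(s, x) = (−s)^{2(1−g)} p(s, (−s)^{g} x)` the profile read off at time `s`): Fubini in `(β, s, x)` gives, for a.e. `(s, x)`,
`Φ(σ, x) = Φ(s, x)` for a.e. `σ < s` (dilation `β ↦ βs`, `β > 1`); Fubini once more: a.e. `σ` is GOOD (`Φ(s, ·) = Φ(σ, ·)` a.e., for a.e.
`s ∈ (σ, S)`); two good times agree a.e. on `ℝ³` (the time window between the later one and `S` has positive measure); a sequence of good
times `σ_n → −∞` then gives ONE profile `Q = Φ(σ₀, ·)` on the whole slab.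

WHAT THIS IS NOT: not NS regularity, not the crux E — measure-theoretic bookkeeping for the census of the crux CLASS 19832 on the MODEL
lattice; `--supports` stmt-19832. [folklore]
-/

noncomputable section

-- flat `Theorems/<Route><Decl>…` files of one crux share the namespace of the crux (tree convention: `Summit.<S>.<S>.…`)
set_option linter.dupNamespace false

open MeasureTheory Set Filter Topology Metric Function TopologicalSpace
open scoped ENNReal NNReal

namespace Summit.NavierStokesRegularity.NavierStokesRegularity.Theorems.PowerGaugeEulerLiouville

open Literature.Analysis Literature.Analysis.FunctionSpaces Literature.Analysis.FluidPDE

namespace PressureSlaving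

/-- **Transport along `β ↦ β s`, one-sided.**  For `s < 0`: if `P (β s)` holds for a.e. `β > 1`, then `P σ` holds for a.e. `σ < s`. [folklore] -/
theorem ae_Iio_of_ae_Ioi_one_mul {s : ℝ} (hs : s < 0) {P : ℝ → Prop}
    (h : ∀ᵐ β ∂(volume.restrict (Ioi (1 : ℝ))), P (β * s)) :
    ∀ᵐ σ ∂(volume.restrict (Iio s)), P σ := by
  have h' : ∀ᵐ β ∂(volume : Measure ℝ), β ∈ Ioi (1 : ℝ) → P (β * s) := (ae_restrict_iff' measurableSet_Ioi).1 h
  have hq := quasiMeasurePreserving_mul_left (inv_ne_zero hs.ne)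
  refine (ae_restrict_iff' measurableSet_Iio).2 ?_
  filter_upwards [hq.ae h'] with σ hσ hσs
  have hσs' : σ < s := hσs
  have hgt : s⁻¹ * σ ∈ Ioi (1 : ℝ) := by
    rw [mem_Ioi, inv_mul_eq_div, lt_div_iff_of_neg hs, one_mul]
    exact hσs'
  have e : s⁻¹ * σ * s = σ := by rw [mul_comm, ← mul_assoc, mul_inv_cancel₀ hs.ne, one_mul]
  have := hσ hgt
  rwa [e] at this

/-- Lebesgue measure restricted to the slab below `S` is the product of the restricted time measure and Lebesgue measure on `ℝ³`. [folklore] -/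
theorem volume_restrict_slab_eq_prod_top (S : ℝ) :
    ((volume : Measure (ℝ × EuclideanSpace ℝ (Fin 3))).restrict
        (Iio S ×ˢ (univ : Set (EuclideanSpace ℝ (Fin 3))))) =
      ((volume : Measure ℝ).restrict (Iio S)).prod (volume : Measure (EuclideanSpace ℝ (Fin 3))) := by
  rw [Measure.volume_eq_prod, ← Measure.prod_restrict, Measure.restrict_univ]

/-- **A ONE-SIDED SCALE-INVARIANT PRESSURE CLASS IS A SELF-SIMILAR ANSATZ.**  Let `S ≤ 0`, let `p` be a.e.-strongly measurable on the slab
`(−∞, S) × ℝ³` and suppose that for every `β ≥ 1`, `p(s, y) = (β^{1−g})² p(β s, β^{g} y)` for a.e. `(s, y)` in the slab.  Then there is a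
measurable `Q : ℝ³ → ℝ` with `p(s) = selfSimilarCollapsePressure g 0 Q s` a.e. on `ℝ³`, i.e. `p(s, y) = (−s)^{2(g−1)} Q((−s)^{−g} y)` for a.e.
`y`, for a.e. `s < S`. [folklore] -/
theorem exists_profile_of_scaleInvariant_oneSided {g S : ℝ} (hS : S ≤ 0) {p : ℝ → EuclideanSpace ℝ (Fin 3) → ℝ}
    (hpm : AEStronglyMeasurable (uncurry p)
      (volume.restrict (Iio S ×ˢ (univ : Set (EuclideanSpace ℝ (Fin 3))))))
    (hinv : ∀ β : ℝ, 1 ≤ β → ∀ᵐ z ∂(volume.restrict (Iio S ×ˢ (univ : Set (EuclideanSpace ℝ (Fin 3))))),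
      p z.1 z.2 = (β ^ (1 - g)) ^ 2 * p (β * z.1) (β ^ g • z.2)) :
    ∃ Q : EuclideanSpace ℝ (Fin 3) → ℝ, Measurable Q ∧
      ∀ᵐ s ∂(volume.restrict (Iio S)), p s =ᵐ[volume] selfSimilarCollapsePressure g 0 Q s := by
  -- ### notation and the strongly measurable modification
  set Sl : Set (ℝ × EuclideanSpace ℝ (Fin 3)) := Iio S ×ˢ (univ : Set (EuclideanSpace ℝ (Fin 3))) with hSl
  have hSlm : MeasurableSet Sl := measurableSet_Iio.prod MeasurableSet.univ
  set μT : Measure ℝ := (volume : Measure ℝ).restrict (Iio S) with hμT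
  set μ : Measure (ℝ × EuclideanSpace ℝ (Fin 3)) := μT.prod (volume : Measure (EuclideanSpace ℝ (Fin 3))) with hμ
  have hμS : (volume : Measure (ℝ × EuclideanSpace ℝ (Fin 3))).restrict Sl = μ := volume_restrict_slab_eq_prod_top S
  set pt : ℝ × EuclideanSpace ℝ (Fin 3) → ℝ := hpm.mk (uncurry p) with hpt
  have hptm : Measurable pt := hpm.stronglyMeasurable_mk.measurable
  have hppt : ∀ᵐ z ∂(volume.restrict Sl), uncurry p z = pt z := hpm.ae_eq_mk
  have hppt' : ∀ᵐ z ∂(volume : Measure (ℝ × EuclideanSpace ℝ (Fin 3))), z ∈ Sl → uncurry p z = pt z :=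
    (ae_restrict_iff' hSlm).1 hppt
  -- ### invariance of the modification (`β ≥ 1` maps the slab into itself)
  have hinvt : ∀ β : ℝ, 1 ≤ β → ∀ᵐ z ∂μ, pt z = (β ^ (1 - g)) ^ 2 * pt (β * z.1, β ^ g • z.2) := by
    intro β hβ1
    have hβ : 0 < β := one_pos.trans_le hβ1
    have hq := quasiMeasurePreserving_selfSimilarMap (c := β ^ g) hβ.ne' (Real.rpow_pos_of_pos hβ g).ne'
    have h2 : ∀ᵐ z ∂(volume : Measure (ℝ × EuclideanSpace ℝ (Fin 3))),
        (β * z.1, β ^ g • z.2) ∈ Sl → uncurry p (β * z.1, β ^ g • z.2) = pt (β * z.1, β ^ g • z.2) := hq.ae hppt'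
    rw [← hμS]
    refine (ae_restrict_iff' hSlm).2 ?_
    filter_upwards [hppt', h2, (ae_restrict_iff' hSlm).1 (hinv β hβ1)] with z h1 h2 h3 hz
    have hz1 : z.1 < S := hz.1
    have hz' : (β * z.1, β ^ g • z.2) ∈ Sl := by
      refine mem_prod.2 ⟨?_, mem_univ _⟩
      show β * z.1 < S
      have hz0 : z.1 < 0 := hz1.trans_le hS
      nlinarith
    have e1 : pt z = p z.1 z.2 := by rw [← h1 hz]; rfl
    have e2 : pt (β * z.1, β ^ g • z.2) = p (β * z.1) (β ^ g • z.2) := by rw [← h2 hz']; rfl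
    rw [e1, e2]
    exact h3 hz
  -- ### the profile read off at time `s`
  set Φ : ℝ → EuclideanSpace ℝ (Fin 3) → ℝ := fun s x => (-s) ^ (2 * (1 - g)) * pt (s, (-s) ^ g • x) with hΦ
  have hΦm : Measurable fun q : ℝ × EuclideanSpace ℝ (Fin 3) => Φ q.1 q.2 := by
    refine (measurable_fst.neg.pow_const _).mul (hptm.comp ?_)
    exact measurable_fst.prodMk ((measurable_fst.neg.pow_const _).smul measurable_snd)
  have hT : ∀ᵐ s ∂μT, s < S := ae_restrict_mem measurableSet_Iio
  have hΦinv : ∀ β : ℝ, 1 ≤ β → ∀ᵐ s ∂μT, ∀ᵐ x ∂(volume : Measure (EuclideanSpace ℝ (Fin 3))),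
      Φ (β * s) x = Φ s x := by
    intro β hβ1
    have hβ : 0 < β := one_pos.trans_le hβ1
    have h1 := Measure.ae_ae_of_ae_prod (hinvt β hβ1)
    filter_upwards [h1, hT] with s hs hsS
    have hns : 0 < -s := neg_pos.2 (hsS.trans_le hS)
    have hc : (-s) ^ g ≠ 0 := (Real.rpow_pos_of_pos hns g).ne'
    have h2 := (Measure.quasiMeasurePreserving_smul (volume : Measure (EuclideanSpace ℝ (Fin 3))) hc).ae hs
    filter_upwards [h2] with x hx
    have eβs : -(β * s) = β * (-s) := by ring
    have hα : (β ^ (1 - g)) ^ 2 = β ^ (2 * (1 - g)) := by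
      rw [show (2 : ℝ) * (1 - g) = (1 - g) * ((2 : ℕ) : ℝ) by push_cast; ring, Real.rpow_mul_natCast hβ.le]
    simp only [hΦ]
    rw [eβs, Real.mul_rpow hβ.le hns.le, Real.mul_rpow hβ.le hns.le, mul_smul, hx, hα]
    ring
  -- ### Fubini in `(β, s, x)`: for a.e. `(s, x)`, `Φ σ x = Φ s x` for a.e. `σ < s`
  have hM : MeasurableSet {q : ℝ × (ℝ × EuclideanSpace ℝ (Fin 3)) | Φ (q.1 * q.2.1) q.2.2 = Φ q.2.1 q.2.2} :=
    measurableSet_eq_fun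
      (hΦm.comp ((measurable_fst.mul measurable_snd.fst).prodMk measurable_snd.snd))
      (hΦm.comp measurable_snd)
  have hMβ : ∀ β : ℝ, MeasurableSet {w : ℝ × EuclideanSpace ℝ (Fin 3) | Φ (β * w.1) w.2 = Φ w.1 w.2} := fun β =>
    measurableSet_eq_fun (hΦm.comp ((measurable_fst.const_mul β).prodMk measurable_snd)) hΦm
  have h3 : ∀ᵐ β ∂((volume : Measure ℝ).restrict (Ioi 1)), ∀ᵐ w ∂μ, Φ (β * w.1) w.2 = Φ w.1 w.2 := by
    refine (ae_restrict_iff' measurableSet_Ioi).2 (ae_of_all _ fun β hβ => ?_)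
    exact (Measure.ae_prod_iff_ae_ae (hMβ β)).2 (hΦinv β (le_of_lt hβ))
  have h4 : ∀ᵐ w ∂μ, ∀ᵐ β ∂((volume : Measure ℝ).restrict (Ioi 1)), Φ (β * w.1) w.2 = Φ w.1 w.2 :=
    (Measure.ae_ae_comm (μ := (volume : Measure ℝ).restrict (Ioi 1)) (ν := μ)
      (p := fun β w => Φ (β * w.1) w.2 = Φ w.1 w.2) hM).1 h3
  have hw1 : ∀ᵐ w ∂μ, w.1 < S := by
    rw [← hμS]
    filter_upwards [ae_restrict_mem hSlm] with w hw
    exact hw.1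
  have h5 : ∀ᵐ w ∂μ, ∀ᵐ σ ∂(volume : Measure ℝ), σ < w.1 → Φ σ w.2 = Φ w.1 w.2 := by
    filter_upwards [h4, hw1] with w hw hwS
    have hw0 : w.1 < 0 := hwS.trans_le hS
    exact (ae_restrict_iff' measurableSet_Iio).1
      (ae_Iio_of_ae_Ioi_one_mul (P := fun σ => Φ σ w.2 = Φ w.1 w.2) hw0 hw)
  -- ### Fubini once more: a.e. `σ` is good
  have hG : MeasurableSet {q : ℝ × (ℝ × EuclideanSpace ℝ (Fin 3)) | q.1 < q.2.1 → Φ q.1 q.2.2 = Φ q.2.1 q.2.2} := by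
    have e : {q : ℝ × (ℝ × EuclideanSpace ℝ (Fin 3)) | q.1 < q.2.1 → Φ q.1 q.2.2 = Φ q.2.1 q.2.2} =
        {q : ℝ × (ℝ × EuclideanSpace ℝ (Fin 3)) | q.1 < q.2.1}ᶜ ∪
          {q : ℝ × (ℝ × EuclideanSpace ℝ (Fin 3)) | Φ q.1 q.2.2 = Φ q.2.1 q.2.2} := by
      ext q
      simp only [mem_setOf_eq, mem_union, mem_compl_iff, imp_iff_not_or]
    rw [e]
    exact (measurableSet_lt measurable_fst measurable_snd.fst).compl.union
      (measurableSet_eq_fun (hΦm.comp (measurable_fst.prodMk measurable_snd.snd)) (hΦm.comp measurable_snd))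
  have h6 : ∀ᵐ σ ∂(volume : Measure ℝ), ∀ᵐ w ∂μ, σ < w.1 → Φ σ w.2 = Φ w.1 w.2 :=
    (Measure.ae_ae_comm (μ := μ) (ν := (volume : Measure ℝ))
      (p := fun w σ => σ < w.1 → Φ σ w.2 = Φ w.1 w.2) (by
        -- the measurable set in the `(w, σ)` order
        have e : {x : (ℝ × EuclideanSpace ℝ (Fin 3)) × ℝ | x.2 < x.1.1 → Φ x.2 x.1.2 = Φ x.1.1 x.1.2} =
            Prod.swap ⁻¹' {q : ℝ × (ℝ × EuclideanSpace ℝ (Fin 3)) | q.1 < q.2.1 → Φ q.1 q.2.2 = Φ q.2.1 q.2.2} := by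
          ext x; simp only [mem_setOf_eq, mem_preimage, Prod.fst_swap, Prod.snd_swap]
        rw [e]; exact measurable_swap hG)).1 h5
  -- ### two good times agree a.e. on `ℝ³`
  have hagree : ∀ σ σ' : ℝ, σ < S → σ' < S →
      (∀ᵐ w ∂μ, σ < w.1 → Φ σ w.2 = Φ w.1 w.2) → (∀ᵐ w ∂μ, σ' < w.1 → Φ σ' w.2 = Φ w.1 w.2) →
      ∀ᵐ x ∂(volume : Measure (EuclideanSpace ℝ (Fin 3))), Φ σ x = Φ σ' x := by
    intro σ σ' hσ hσ' hgood hgood'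
    set σm : ℝ := max σ σ' with hσm
    have hσmS : σm < S := max_lt hσ hσ'
    have h1 : ∀ᵐ w ∂μ, σm < w.1 → Φ σ w.2 = Φ σ' w.2 := by
      filter_upwards [hgood, hgood'] with w hw hw' hlt
      rw [hw ((le_max_left _ _).trans_lt hlt), hw' ((le_max_right _ _).trans_lt hlt)]
    have h2 : ∀ᵐ s ∂μT, ∀ᵐ x ∂(volume : Measure (EuclideanSpace ℝ (Fin 3))), σm < s → Φ σ x = Φ σ' x :=
      Measure.ae_ae_of_ae_prod (p := fun w : ℝ × EuclideanSpace ℝ (Fin 3) => σm < w.1 → Φ σ w.2 = Φ σ' w.2) h1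
    -- restrict to the window `(σm, S)`, which has positive measure
    have h3 : ∀ᵐ s ∂(μT.restrict (Ioi σm)), ∀ᵐ x ∂(volume : Measure (EuclideanSpace ℝ (Fin 3))), Φ σ x = Φ σ' x := by
      filter_upwards [ae_restrict_of_ae h2, ae_restrict_mem measurableSet_Ioi] with s hs hsm
      filter_upwards [hs] with x hx
      exact hx hsm
    have hne : μT.restrict (Ioi σm) ≠ 0 := by
      rw [hμT, Measure.restrict_restrict measurableSet_Ioi, Ne, Measure.restrict_eq_zero]
      have e : Ioi σm ∩ Iio S = Ioo σm S := by ext t; simp [and_comm]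
      rw [e, Real.volume_Ioo, ENNReal.ofReal_eq_zero, not_le]
      linarith
    haveI : (ae (μT.restrict (Ioi σm))).NeBot := ae_neBot.2 hne
    obtain ⟨s, hs⟩ := h3.exists
    exact hs
  -- ### a sequence of good times `σ_n → −∞`
  have hex : ∀ n : ℕ, ∃ σ : ℝ, σ ∈ Ioo (S - n - 2) (S - n - 1) ∧
      ∀ᵐ w ∂μ, σ < w.1 → Φ σ w.2 = Φ w.1 w.2 := by
    intro n
    have h1 : ∀ᵐ σ ∂((volume : Measure ℝ).restrict (Ioo (S - n - 2) (S - n - 1))),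
        σ ∈ Ioo (S - n - 2) (S - n - 1) ∧ ∀ᵐ w ∂μ, σ < w.1 → Φ σ w.2 = Φ w.1 w.2 := by
      filter_upwards [ae_restrict_mem measurableSet_Ioo, ae_restrict_of_ae h6] with σ h1 h2
      exact ⟨h1, h2⟩
    have hne : (volume : Measure ℝ).restrict (Ioo (S - n - 2) (S - n - 1)) ≠ 0 := by
      rw [Ne, Measure.restrict_eq_zero, Real.volume_Ioo, ENNReal.ofReal_eq_zero, not_le]
      linarith
    haveI : (ae ((volume : Measure ℝ).restrict (Ioo (S - n - 2) (S - n - 1)))).NeBot := ae_neBot.2 hne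
    exact h1.exists
  choose σs hσs using hex
  have hσS : ∀ n, σs n < S := fun n => by
    have := (hσs n).1.2
    have hn : (0 : ℝ) ≤ n := n.cast_nonneg
    linarith
  refine ⟨fun x => Φ (σs 0) x, hΦm.comp (measurable_const.prodMk measurable_id), ?_⟩
  -- `Φ (σ_n, ·) = Q` a.e. for every `n`
  have hQn : ∀ n : ℕ, ∀ᵐ x ∂(volume : Measure (EuclideanSpace ℝ (Fin 3))), Φ (σs n) x = Φ (σs 0) x := fun n =>
    hagree (σs n) (σs 0) (hσS n) (hσS 0) (hσs n).2 (hσs 0).2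
  -- ### `Φ s x = Q x` for a.e. `(s, x)`
  have hall : ∀ᵐ w ∂μ, ∀ n : ℕ, (σs n < w.1 → Φ (σs n) w.2 = Φ w.1 w.2) ∧ Φ (σs n) w.2 = Φ (σs 0) w.2 := by
    refine ae_all_iff.2 fun n => ?_
    filter_upwards [(hσs n).2,
      (Measure.quasiMeasurePreserving_snd (μ := μT) (ν := (volume : Measure (EuclideanSpace ℝ (Fin 3))))).ae (hQn n)]
      with w h1 h2
    exact ⟨h1, h2⟩
  have hΦQ : ∀ᵐ w ∂μ, Φ w.1 w.2 = Φ (σs 0) w.2 := by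
    filter_upwards [hall, hw1] with w hw hwS
    obtain ⟨n, hn⟩ := exists_nat_ge (S - 1 - w.1)
    have hlt : σs n < w.1 := by
      have := (hσs n).1.2
      linarith
    rw [← (hw n).1 hlt, (hw n).2]
  -- ### back to `p`
  have h7 : ∀ᵐ s ∂μT, ∀ᵐ x ∂(volume : Measure (EuclideanSpace ℝ (Fin 3))), Φ s x = Φ (σs 0) x :=
    Measure.ae_ae_of_ae_prod (p := fun w : ℝ × EuclideanSpace ℝ (Fin 3) => Φ w.1 w.2 = Φ (σs 0) w.2) hΦQ
  have h8 : ∀ᵐ s ∂μT, ∀ᵐ y ∂(volume : Measure (EuclideanSpace ℝ (Fin 3))), uncurry p (s, y) = pt (s, y) := by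
    have h := hppt
    rw [hμS] at h
    exact Measure.ae_ae_of_ae_prod h
  filter_upwards [h7, h8, hT] with s h7s h8s hsS
  have hns : 0 < -s := neg_pos.2 (hsS.trans_le hS)
  have hc : (-s) ^ (-g) ≠ 0 := (Real.rpow_pos_of_pos hns (-g)).ne'
  have h9 := (Measure.quasiMeasurePreserving_smul (volume : Measure (EuclideanSpace ℝ (Fin 3))) hc).ae h7s
  filter_upwards [h9, h8s] with y hy hpy
  have hcancel : (-s) ^ g • (-s) ^ (-g) • y = y := by
    rw [smul_smul, ← Real.rpow_add hns, add_neg_cancel, Real.rpow_zero, one_smul]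
  have hA : (0 : ℝ) < (-s) ^ (2 * (1 - g)) := Real.rpow_pos_of_pos hns _
  have hy' : (-s) ^ (2 * (1 - g)) * pt (s, y) = Φ (σs 0) ((-s) ^ (-g) • y) := by
    rw [← hy]
    simp only [hΦ]
    rw [hcancel]
  have hpy' : p s y = pt (s, y) := hpy
  rw [selfSimilarCollapsePressure_apply, zero_sub, hpy', (eq_inv_mul_iff_mul_eq₀ hA.ne').2 hy',
    ← Real.rpow_neg hns.le]
  congr 1
  ring_nf

end PressureSlaving

end Summit.NavierStokesRegularity.NavierStokesRegularity.Theorems.PowerGaugeEulerLiouville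

end
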